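import Literature.NumberTheory.EllipticCurves.Rank1Residual.Typed.X5DescentRoute
import Literature.NumberTheory.EllipticCurves.Rank1Residual.Typed.X5DescentPairing
import Literature.NumberTheory.EllipticCurves.Rank1Residual.Typed.X5DescentItem
import Literature.NumberTheory.EllipticCurves.Wuthrich2014.ShaBoundProofs
import Literature.NumberTheory.EllipticCurves.ComplexMultiplicationLFunctionIsogenyHoldsProofs
import HarnessLib

/-!
# Class X5 (`p = 2`): the remaining VERDICT SHAPES of the census as instances of the X5 descent datum —
# engine G / engine-H mode A as `X5.DescentCertificateAt`, and ISOGENY TRANSPORT of `BSD(E,2)`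
# (cell `b2b-bsdres`, unit `b2b-bsdres-sha-1`, gen 5; joins `Typed/X5DescentRoute.lean`, `Typed/X5DescentPairing.lean`, `Typed/X5DescentItem.lean`)

HONEST FRAMING (run/shared/lean/b2b/bsd-rank1-residual/, verbatim): prove what is provable now;
shrink each hard class to its core with data; no claim beyond stated classes. X5 stays
CONSTRUCTION-SHAPED; every published input enters as one of the tree's EXISTING named facts, as a
HYPOTHESIS (`exists_casselsTate_pairing` = bsd.S18; `bsdRHS_eq_of_isIsogenous` = Cassels 1965 /
Milne ADT I.7.3; `hasEntireLFunction_rat` = modularity); nothing is booked; no `sorry`.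

The per-curve verdicts of the X5-core census (`SHA-CENSUS.md` §3.5–§3.6, certificate
`certs/sha/x7_desc8_p2.json`) come in four shapes; each is here an instance of the SINGLE datum
`X5.DescentCertificateAt W` of `Typed/X5DescentRoute.lean` (so that the class bridge
`X5.bsdp_of_forall_descentCertificate` consumes all of them uniformly) or of `BSDp W 2` directly:
* `two-engine` with engine H mode S — `X5.descentCertificateAt_of_eightDescent` (X5DescentRoute);
* `two-engine` with engine H mode A, and `single-G` (engine G bits) — HERE:
  `X5.descentCertificateAt_of_casselsTate_witness` (ONE non-divisible order-4 witness + bsd.S18 +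
  `Ш` finite), its ITEM FORM `X5.descentCertificateAt_of_casselsTate_item` (the witness read off
  ONE engine-H item — a `4`-covering above a Ш-type `2`-covering with EMPTY fake `2`-Selmer set —
  over the Kummer–Selmer diagram at levels `4 | 8`, `Typed/X5DescentItem.lean`: valid at EVERY
  torsion rank, no whole-`Ш[2]`-class condition), and `X5.descentCertificateAt_of_pairing_bits`
  (any bi-additive pairing exhibiting engine G's bits; structure-free), all at level `k = 2`,
  exponent `m = 4`, through `stable_four_of_pairing_witness` / `stable_four_of_pairing_bits`
  (X5DescentPairing) and `card_torsionBy_four_of_two_divisible` (`#Ш[4] = 16` from `#Ш[2] = 4`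
  and `Ш[2] ⊆ 2Ш`);
* `transport` (2742b2 ← 2742b1, 12870o3 ← 12870o1: the certified member of the isogeny class
  carries the datum, the other member inherits `BSD(E,2)`) — HERE: `X5.bsdp_two_of_isIsogenous`
  (Cassels' isogeny invariance of the BSD quotient through the tree theorem
  `Wuthrich2014.bsdp_of_isIsogenous`; `L^{(r)}(E',1) ≠ 0` from modularity via
  `leadingLCoeff_ne_zero_holds`; `r_an` is an isogeny invariant) and
  `X5.bsdp_two_of_isIsogenous_of_descentCertificateAt`;
* `lower-bound-only` (19074h1, 19074h2, `ord₂ #Ш_an = 6`): NO instance — the level-3 datum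
  `Ш[16] = Ш[8]` is not certified by any engine of the cell; these curves stay OPEN (typed
  `MissingUpperBoundAt`), as the census says.

References: Silverman *AEC* X.4.14 [SilvermanAEC2009]; Cassels 1962/1965 [Cassels1962ArithmeticIV];
Milne *ADT* Thm. I.7.3 [MilneADT2006]; Miller 2011 §1, Def. 1.1 [Miller2011LMS]; Stamminger 2005
Thm. 6.2.2 [Stamminger2005]; Swinnerton-Dyer 2013 §1 [SwinnertonDyer2013].
-/

noncomputable section

open scoped Classical

open WeierstrassCurve Literature.NumberTheory.EllipticCurves
  Literature.NumberTheory.EllipticCurves.Rank1Residual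

namespace Literature.NumberTheory.EllipticCurves.Rank1Residual.Typed

section Sha

variable (W : WeierstrassCurve ℚ)

/-- **Engine G bits ⇒ the X5 descent datum** (level `2`, exponent `4`): any bi-additive pairing on
`Ш(E/ℚ)` exhibiting engine G's `m = 1` bits, `#Ш[2] = 4`, `Ш[2] ⊆ 2Ш`, `#Ш_an = q`, `ord₂ q = 4`.
Structure-free. [cite: SwinnertonDyer2013, §1] [cite: Miller2011LMS, Def. 1.1] -/
theorem X5.descentCertificateAt_of_pairing_bits {Q : Type*} [AddCommGroup Q]
    (B : W.sha →+ W.sha →+ Q) (h2 : Nat.card (AddSubgroup.torsionBy W.sha 2) = 4)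
    (hdiv : ∀ z : W.sha, 2 • z = 0 → ∃ w : W.sha, 2 • w = z)
    (hbits : ∀ ξ : W.sha, 2 • ξ = 0 → ξ ≠ 0 → ∃ η y : W.sha, 2 • η = ξ ∧ 2 • y = 0 ∧ B η y ≠ 0)
    {q : ℚ} (hq : shaAn W = (q : ℂ)) (hv : padicValRat 2 q = 4) : X5.DescentCertificateAt W :=
  X5.descentCertificateAt_of_level W (k := 2) (m := 4)
    (by simpa using stable_four_of_pairing_bits B hdiv hbits)
    (by simpa using X5.card_sha_four_eq_sixteen W h2 hdiv) hq hv

variable [W.IsElliptic]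

/-- **Engine-H mode A ⇒ the X5 descent datum** (level `2`, exponent `4`): ONE `η₀ ∈ Ш[4]` of exact
order `4` not divisible by `2` in `Ш`, the Cassels–Tate named fact (`hCT`, bsd.S18), `Ш` finite,
`#Ш[2] = 4`, `Ш[2] ⊆ 2Ш`, `#Ш_an = q`, `ord₂ q = 4`. [cite: Stamminger2005, Thm. 6.2.2 (p. 73)]
[cite: SilvermanAEC2009, Thm. X.4.14] -/
theorem X5.descentCertificateAt_of_casselsTate_witness
    (hCT : WeierstrassCurve.exists_casselsTate_pairing (K := ℚ)) (hfin : W.ShaFinite)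
    (h2 : Nat.card (AddSubgroup.torsionBy W.sha 2) = 4)
    (hdiv : ∀ z : W.sha, 2 • z = 0 → ∃ w : W.sha, 2 • w = z)
    (hη : ∃ η₀ : W.sha, 4 • η₀ = 0 ∧ 2 • η₀ ≠ 0 ∧ ¬ ∃ w : W.sha, 2 • w = η₀)
    {q : ℚ} (hq : shaAn W = (q : ℂ)) (hv : padicValRat 2 q = 4) : X5.DescentCertificateAt W := by
  haveI : Finite W.sha := hfin
  obtain ⟨B, halt, horth⟩ := sha_orthogonal_two_of_casselsTate W hCT
  have hstab : ∀ x : W.sha, 8 • x = 0 → 4 • x = 0 :=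
    stable_four_of_pairing_witness B halt (fun x _ hx => horth x hx) hdiv (by simpa using h2) hη
  exact X5.descentCertificateAt_of_level W (k := 2) (m := 4) (by simpa using hstab)
    (by simpa using X5.card_sha_four_eq_sixteen W h2 hdiv) hq hv


/-- **Engine-H mode A, ITEM FORM (any torsion rank), as the X5 descent datum** (granted bsd.S18
`hCT` and `Ш` finite): `#Ш[2] = 4`, `Ш[2] ⊆ 2Ш`, the Kummer–Selmer diagram of `E` at levels `4 | 8`
mapping to `Ш(E/ℚ)` (`Typed/X5DescentItem.lean`), ONE `4`-covering `s` above a Ш-type `2`-covering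
with no everywhere-locally-soluble `2`-covering (EMPTY fake `2`-Selmer set), `#Ш_an = q`,
`ord₂ q = 4` ⟹ `X5.DescentCertificateAt W` (level `2`, exponent `4`; `#Ш[4] = 16` is derived).
[cite: Stamminger2005, §1.3 and Thm. 6.2.2] [cite: SilvermanAEC2009, §X.4, Thm. X.4.2 and Thm. X.4.14] -/
theorem X5.descentCertificateAt_of_casselsTate_item
    (hCT : WeierstrassCurve.exists_casselsTate_pairing (K := ℚ)) (hfin : W.ShaFinite)
    (h2 : Nat.card (AddSubgroup.torsionBy W.sha 2) = 4)
    (hdiv : ∀ z : W.sha, 2 • z = 0 → ∃ w : W.sha, 2 • w = z)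
    {S₄ S₈ : Type*} [AddCommGroup S₄] [AddCommGroup S₈]
    (π₄ : S₄ →+ W.sha) (π₈ : S₈ →+ W.sha) (d : S₈ →+ S₄)
    (hcomm : ∀ z : S₈, π₄ (d z) = 2 • π₈ z)
    (hsurj : ∀ w : W.sha, 8 • w = 0 → ∃ z : S₈, π₈ z = w)
    (hker : ∀ s : S₄, π₄ s = 0 → ∃ z : S₈, d z = s)
    {s : S₄} (h4 : 4 • π₄ s = 0) (hξ : 2 • π₄ s ≠ 0) (hs : ¬ ∃ z : S₈, d z = s)
    {q : ℚ} (hq : shaAn W = (q : ℂ)) (hv : padicValRat 2 q = 4) : X5.DescentCertificateAt W :=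
  X5.descentCertificateAt_of_casselsTate_witness W hCT hfin h2 hdiv
    (exists_witness_of_item π₄ π₈ d hcomm hsurj hker h4 hξ hs) hq hv

variable [W.IsGloballyMinimal]

/-- **Isogeny transport of `BSD(E,2)` on the X5 core** (verdict `transport`: 2742b2 ← 2742b1,
12870o3 ← 12870o1). From `BSD(W',2)`, `r_an(W') ≤ 1` (so `Ш(W')` finite by GZK) along a
`ℚ`-isogeny `W ~ W'`: `r_an(W) ≤ 1 ∧ BSD(W,2)`. Inputs as hypotheses: GZK (`hGZK`), Cassels'
isogeny invariance of the BSD quotient (`hCassels`, named fact `bsdRHS_eq_of_isIsogenous`),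
modularity (`hmod`, `hasEntireLFunction_rat`, for `L^{(r)}(W',1) ≠ 0`).
[cite: MilneADT2006, Thm. I.7.3] [cite: Miller2011LMS, §1] -/
theorem X5.bsdp_two_of_isIsogenous (hGZK : rank_eq_analyticRank_of_analyticRank_le_one)
    (hCassels : bsdRHS_eq_of_isIsogenous) (hmod : hasEntireLFunction_rat)
    {W' : WeierstrassCurve ℚ} [W'.IsElliptic] [W'.IsGloballyMinimal] (hiso : IsIsogenous W W')
    (hr' : W'.analyticRank ≤ 1) (h : BSDp W' 2) : W.analyticRank ≤ 1 ∧ BSDp W 2 := by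
  haveI : Fact (Nat.Prime 2) := ⟨Nat.prime_two⟩
  exact ⟨(analyticRank_eq_of_isIsogenous' hiso).le.trans hr',
    Wuthrich2014.bsdp_of_isIsogenous hCassels hiso (hGZK W' hr').2
      (W'.leadingLCoeff_ne_zero_holds (hmod W')) h⟩

/-- **Transport of the datum's conclusion**: an X5 descent datum on the isogenous member `W'`
(`r_an(W') ≤ 1`) gives `BSD(W,2)`. [cite: MilneADT2006, Thm. I.7.3] [cite: Miller2011LMS, §1] -/
theorem X5.bsdp_two_of_isIsogenous_of_descentCertificateAt
    (hGZK : rank_eq_analyticRank_of_analyticRank_le_one)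
    (hCassels : bsdRHS_eq_of_isIsogenous) (hmod : hasEntireLFunction_rat)
    {W' : WeierstrassCurve ℚ} [W'.IsElliptic] [W'.IsGloballyMinimal] (hiso : IsIsogenous W W')
    (hr' : W'.analyticRank ≤ 1) (h : X5.DescentCertificateAt W') : BSDp W 2 :=
  (X5.bsdp_two_of_isIsogenous W hGZK hCassels hmod hiso hr'
    (X5.bsdp_two_of_descentCertificateAt W' hGZK hr' h)).2

end Sha

end Literature.NumberTheory.EllipticCurves.Rank1Residual.Typed

end
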